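import Literature.NumberTheory.LFunctions.WeilArchimedeanPositivityProofs
import Literature.NumberTheory.LFunctions.WeilMellinInversion
import Literature.NumberTheory.LFunctions.WeilArchimedeanMoments
import HarnessLib

/-!
# The analytic form of Weil's quadratic functional on the first-prime cone `C((log 3)/2)`

For a test function `g` with `tsupport g ⊆ [-(log 3)/2, (log 3)/2]` the kernel `k = g ⋆ g̃` is
supported in `[-log 3, log 3]`, so exactly ONE prime power enters the explicit formula, `n = 2`:
`W(k) = k^(0) + k^(1) − (log 2/√2)(k(log 2) + k(−log 2)) + W_∞(k)`. By Mellin (Fourier) inversion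
on the critical line, `2π k(±log 2) = ∫ |ĝ(1/2+it)|² e^{∓it log 2} dt`, so the prime 2 is
DIAGONAL in frequency and Weil's quadratic functional takes Yoshida's analytic shape with a
rippled weight:

`Re Q(g) = E₂(g) := 2 Re(ĝ(0) conj ĝ(1)) − (log π)‖g‖₂² + (1/2π) ∫ |ĝ(1/2+it)|² w₂(t) dt`,
`w₂(t) = Re ψ(1/4 + it/2) − √2 log 2 · cos(t log 2)` (`weilFirstPrimeWeight`,
`weilFirstPrimeQuadratic`, `weilQuadratic_re_eq_weilFirstPrimeQuadratic`).

Hence first-prime Weil positivity `WeilPositivityOn ((log 3)/2)` (route WeilPos #2, Connes'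
semi-local positivity for `S = {∞, 2}`) is EQUIVALENT to `E₂ ≥ 0` on `C((log 3)/2)`
(`weilPositivityOn_log_three_half_iff`) — the reduction consumed by a moment-method certificate
in the style of `WeilPositivityCertificate.lean` (Yoshida 1992, Thm 1, for the archimedean cone).
Everything here is proved; there are no named facts.

## References

* H. Yoshida, *On Hermitian forms attached to zeta functions*, Adv. Stud. Pure Math. 21 (1992),
  §2 eq. (2.1) (the analytic form; here with the `p = 2` term of (2.1) kept).
* E. Bombieri, *Remarks on Weil's quadratic functional in the theory of prime numbers I*, Rend.
  Mat. Acc. Lincei (9) 11 (2000), Thm 2 (explicit formula), §2 (Mellin inversion).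
* A. Connes, C. Consani, *Spectral triples and ζ-cycles*, arXiv:2106.01715, §2.3 (the semi-local
  Weil quadratic form at `λ² = 3`).
-/

noncomputable section

open Complex Filter Set MeasureTheory
open scoped Real Topology ComplexConjugate

namespace Literature.NumberTheory.LFunctions

variable {g : ℝ → ℂ}

/-! ## The rippled weight and the analytic form -/

/-- The first-prime Weil weight `w₂(t) = Re ψ(1/4 + it/2) − √2 log 2 · cos(t log 2)`: the
archimedean density of Yoshida's (2.1) minus the frequency-side image of the prime-2 spike
`(log 2/√2)(δ_{log 2} + δ_{−log 2})`. [cite: Yoshida1992, §2 eq. (2.1) with the p = 2 term] -/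
def weilFirstPrimeWeight (t : ℝ) : ℝ :=
  Literature.Analysis.SpecialFunctions.reDigammaQuarter t -
    Real.sqrt 2 * Real.log 2 * Real.cos (t * Real.log 2)

/-- The first-prime analytic form
`E₂(g) = 2 Re(ĝ(0) conj ĝ(1)) − (log π) ‖g‖₂² + (1/2π) ∫ |ĝ(1/2+it)|² w₂(t) dt`. [cite: Yoshida1992, §2 eq. (2.1) with the p = 2 term] -/
def weilFirstPrimeQuadratic (g : ℝ → ℂ) : ℝ :=
  2 * (weilMellin g 0 * conj (weilMellin g 1)).re - Real.log π * weilNorm2Sq g +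
    1 / (2 * π) * ∫ t : ℝ, ‖weilMellin g (1 / 2 + t * I)‖ ^ 2 * weilFirstPrimeWeight t

/-- The weight is measurable. [folklore] -/
theorem measurable_weilFirstPrimeWeight : Measurable weilFirstPrimeWeight :=
  Literature.Analysis.SpecialFunctions.measurable_reDigammaQuarter.sub (by fun_prop)

/-- `|w₂(t)| ≤ (|Re ψ| bound) + √2 log 2`: quadratic growth, from `abs_reDigammaQuarter_le`. [folklore] -/
theorem abs_weilFirstPrimeWeight_le (t : ℝ) :
    |weilFirstPrimeWeight t| ≤ (|0| + Real.sqrt 2 * Real.log 2) + 0 * t ^ 2 ∨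
      |weilFirstPrimeWeight t| ≤
        |Literature.Analysis.SpecialFunctions.reDigammaQuarter t| + Real.sqrt 2 * Real.log 2 := by
  right
  unfold weilFirstPrimeWeight
  refine (abs_sub _ _).trans (add_le_add le_rfl ?_)
  rw [abs_mul, abs_of_nonneg (by positivity : (0 : ℝ) ≤ Real.sqrt 2 * Real.log 2)]
  exact mul_le_of_le_one_right (by positivity) (Real.abs_cos_le_one _)

/-- `t ↦ |ĝ(1/2+it)|² w₂(t)` is integrable. [folklore] -/
theorem integrable_norm_sq_weilMellin_mul_weilFirstPrimeWeight (hg : IsWeilTest g) :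
    Integrable fun t : ℝ ↦ ‖weilMellin g (1 / 2 + t * I)‖ ^ 2 * weilFirstPrimeWeight t := by
  have h1 := integrable_norm_sq_weilMellin_mul_reDigammaQuarter hg
  have h2 : Integrable fun t : ℝ ↦
      ‖weilMellin g (1 / 2 + t * I)‖ ^ 2 * (Real.sqrt 2 * Real.log 2 * Real.cos (t * Real.log 2)) :=
    integrable_norm_sq_weilMellin_mul hg (by fun_prop) (A := Real.sqrt 2 * Real.log 2) (B := 0)
      (by positivity) le_rfl fun t ↦ by
        rw [zero_mul, add_zero, abs_mul, abs_of_nonneg (by positivity : (0 : ℝ) ≤ Real.sqrt 2 * Real.log 2)]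
        exact mul_le_of_le_one_right (by positivity) (Real.abs_cos_le_one _)
  have e : (fun t : ℝ ↦ ‖weilMellin g (1 / 2 + t * I)‖ ^ 2 * weilFirstPrimeWeight t) =
      fun t : ℝ ↦ ‖weilMellin g (1 / 2 + t * I)‖ ^ 2 * Literature.Analysis.SpecialFunctions.reDigammaQuarter t -
        ‖weilMellin g (1 / 2 + t * I)‖ ^ 2 * (Real.sqrt 2 * Real.log 2 * Real.cos (t * Real.log 2)) := by
    funext t; unfold weilFirstPrimeWeight; ring
  rw [e]
  exact h1.sub h2

/-! ## Only the prime 2 enters on the window `[-log 3, log 3]` -/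

/-- For a continuous `k` with `tsupport k ⊆ [-log 3, log 3]` the prime term of `W` is the single
spike `(log 2/√2)(k(log 2) + k(−log 2))`: `k(±log 3) = 0` because the support is open inside the
closed window, and `log n ≥ log 3` for `n ≥ 3`. [cite: Bombieri2000Weil, Thm 2 (prime side) restricted to supp ⊆ [−log 3, log 3]] -/
theorem weilPrimeTerm_of_tsupport_subset_log_three {k : ℝ → ℂ} (hk : Continuous k)
    (hsupp : tsupport k ⊆ Icc (-Real.log 3) (Real.log 3)) :
    weilPrimeTerm k =
      ((Real.log 2 : ℝ) : ℂ) / (Real.sqrt 2 : ℂ) * (k (Real.log 2) + k (-Real.log 2)) := by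
  have hIoo : Function.support k ⊆ Ioo (-Real.log 3) (Real.log 3) :=
    support_subset_Ioo_of_tsupport_subset_Icc hk hsupp
  have hzero : ∀ x : ℝ, Real.log 3 ≤ |x| → k x = 0 := by
    intro x hx
    by_contra hne
    have hmem := hIoo (Function.mem_support.2 hne)
    rw [mem_Ioo] at hmem
    have : |x| < Real.log 3 := abs_lt.2 ⟨hmem.1, hmem.2⟩
    linarith
  unfold weilPrimeTerm
  rw [tsum_eq_single 2]
  · push_cast
    rw [ArithmeticFunction.vonMangoldt_apply_prime Nat.prime_two]
    push_cast
    ring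
  · intro n hn
    rcases Nat.lt_or_ge n 3 with h3 | h3
    · interval_cases n <;> simp_all
    · have hn' : (3 : ℝ) ≤ n := by exact_mod_cast h3
      have hlog : Real.log 3 ≤ Real.log n := Real.log_le_log (by norm_num) hn'
      have hpos : 0 ≤ Real.log n := (Real.log_nonneg (by norm_num)).trans hlog
      rw [hzero _ (by rwa [abs_of_nonneg hpos]), hzero _ (by rwa [abs_neg, abs_of_nonneg hpos])]
      simp

/-! ## The prime 2 is diagonal in frequency -/

/-- Mellin inversion on the critical line for the kernel `k = g ⋆ g̃`:
`2π (k(log 2) + k(−log 2)) = ∫ |ĝ(1/2+it)|² · 2cos(t log 2) dt` (as complex numbers). [cite: Bombieri2000Weil, §2 (inverse Mellin transform) applied to g ⋆ g̃ at t = ± log 2] -/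
theorem weilConv_weilReflect_log_two_add (hg : IsWeilTest g) :
    2 * π * (weilConv g (weilReflect g) (Real.log 2) + weilConv g (weilReflect g) (-Real.log 2)) =
      ((∫ t : ℝ, ‖weilMellin g (1 / 2 + t * I)‖ ^ 2 * (2 * Real.cos (t * Real.log 2)) : ℝ) : ℂ) := by
  have hk : IsWeilTest (weilConv g (weilReflect g)) := hg.weilConv hg.weilReflect
  have h1 := weilMellin_inversion hk (1 / 2) (Real.log 2)
  have h2 := weilMellin_inversion hk (1 / 2) (-Real.log 2)
  have e0 : ((1 / 2 : ℝ) : ℂ) - 1 / 2 = 0 := by push_cast; ring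
  simp only [e0, zero_mul, Complex.exp_zero, mul_one] at h1 h2
  have hb1 : ∀ y : ℝ, ‖cexp (-(y * I) * (Real.log 2 : ℝ))‖ ≤ 1 := fun y ↦ by
    rw [show -(y * I : ℂ) * (Real.log 2 : ℝ) = ((-(y * Real.log 2) : ℝ) : ℂ) * I by push_cast; ring,
      Complex.norm_exp_ofReal_mul_I]
  have hb2 : ∀ y : ℝ, ‖cexp (-(y * I) * ((-Real.log 2 : ℝ) : ℂ))‖ ≤ 1 := fun y ↦ by
    rw [show -(y * I : ℂ) * ((-Real.log 2 : ℝ) : ℂ) = (((y * Real.log 2) : ℝ) : ℂ) * I by push_cast; ring,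
      Complex.norm_exp_ofReal_mul_I]
  have hi1 : Integrable fun y : ℝ ↦
      weilMellin (weilConv g (weilReflect g)) ((1 / 2 : ℝ) + y * I) * cexp (-(y * I) * (Real.log 2 : ℝ)) :=
    integrable_weilMellin_vertical_mul hk (1 / 2) (by fun_prop) hb1
  have hi2 : Integrable fun y : ℝ ↦
      weilMellin (weilConv g (weilReflect g)) ((1 / 2 : ℝ) + y * I) * cexp (-(y * I) * ((-Real.log 2 : ℝ) : ℂ)) :=
    integrable_weilMellin_vertical_mul hk (1 / 2) (by fun_prop) hb2
  rw [mul_add, ← h1, ← h2, ← integral_add hi1 hi2, ← integral_complex_ofReal]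
  congr 1 with t
  have ht : ((1 / 2 : ℝ) : ℂ) + t * I = 1 / 2 + t * I := by push_cast; ring
  rw [ht, weilMellin_weilConv_weilReflect_half hg t]
  have hcos : cexp (-(t * I) * (Real.log 2 : ℝ)) + cexp (-(t * I) * ((-Real.log 2 : ℝ) : ℂ)) =
      ((2 * Real.cos (t * Real.log 2) : ℝ) : ℂ) := by
    have e1 : -(t * I : ℂ) * (Real.log 2 : ℝ) = -((t * Real.log 2 : ℝ) : ℂ) * I := by push_cast; ring
    have e2 : -(t * I : ℂ) * ((-Real.log 2 : ℝ) : ℂ) = ((t * Real.log 2 : ℝ) : ℂ) * I := by push_cast; ring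
    rw [e1, e2, add_comm, ← Complex.two_cos]
    push_cast
    ring
  rw [← mul_add, hcos]
  push_cast
  ring

/-! ## The analytic form on the first-prime cone -/

/-- **`Q(g)` in analytic form on `C((log 3)/2)`.** For `tsupport g ⊆ [-(log 3)/2, (log 3)/2]`,
`W(g ⋆ g̃) = E₂(g)` as a complex number: polar term `2 Re(ĝ(0) conj ĝ(1))`, prime term
`(log 2/√2)·(1/2π)∫|ĝ|² 2cos(t log 2)`, archimedean term `(1/2π)∫|ĝ|² Re ψ(1/4+it/2) − (log π)‖g‖₂²`.
[cite: Yoshida1992, §2 eq. (2.1) with the p = 2 term; ConnesConsani2023 §2.3] -/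
theorem weilQuadratic_eq_weilFirstPrimeQuadratic (hg : IsWeilTest g)
    (hsupp : tsupport g ⊆ Icc (-(Real.log 3 / 2)) (Real.log 3 / 2)) :
    weilQuadratic g = (weilFirstPrimeQuadratic g : ℂ) := by
  have hk : IsWeilTest (weilConv g (weilReflect g)) := hg.weilConv hg.weilReflect
  have hks : tsupport (weilConv g (weilReflect g)) ⊆ Icc (-Real.log 3) (Real.log 3) := by
    have h := tsupport_weilConv_weilReflect_subset (a := Real.log 3 / 2) hg.2 hsupp
    convert h using 2 <;> ring
  have hpi : (2 * π : ℂ) ≠ 0 := by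
    have : (0 : ℝ) < 2 * π := by positivity
    exact_mod_cast this.ne'
  have hprime : weilConv g (weilReflect g) (Real.log 2) + weilConv g (weilReflect g) (-Real.log 2) =
      (1 / (2 * π) : ℂ) * ((∫ t : ℝ, ‖weilMellin g (1 / 2 + t * I)‖ ^ 2 * (2 * Real.cos (t * Real.log 2)) : ℝ) : ℂ) := by
    rw [← weilConv_weilReflect_log_two_add hg]
    field_simp
  -- the two weighted integrals
  have hI1 := integrable_norm_sq_weilMellin_mul_reDigammaQuarter hg
  have hI2 : Integrable fun t : ℝ ↦
      ‖weilMellin g (1 / 2 + t * I)‖ ^ 2 * (2 * Real.cos (t * Real.log 2)) :=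
    integrable_norm_sq_weilMellin_mul hg (by fun_prop) (A := 2) (B := 0) (by norm_num) le_rfl
      fun t ↦ by
        rw [zero_mul, add_zero, abs_mul, abs_two]
        exact mul_le_of_le_one_right (by norm_num) (Real.abs_cos_le_one _)
  have hsplit : ∫ t : ℝ, ‖weilMellin g (1 / 2 + t * I)‖ ^ 2 * weilFirstPrimeWeight t =
      (∫ t : ℝ, ‖weilMellin g (1 / 2 + t * I)‖ ^ 2 * Literature.Analysis.SpecialFunctions.reDigammaQuarter t) -
        Real.sqrt 2 * Real.log 2 / 2 *
          ∫ t : ℝ, ‖weilMellin g (1 / 2 + t * I)‖ ^ 2 * (2 * Real.cos (t * Real.log 2)) := by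
    rw [← integral_const_mul, ← integral_sub hI1 (hI2.const_mul _)]
    congr 1 with t
    unfold weilFirstPrimeWeight
    ring
  have hsqrt : Real.log 2 / Real.sqrt 2 = Real.sqrt 2 * Real.log 2 / 2 := by
    have h2 : Real.sqrt 2 * Real.sqrt 2 = 2 := Real.mul_self_sqrt (by norm_num)
    have hs : Real.sqrt 2 ≠ 0 := by positivity
    field_simp
    nlinarith [h2]
  unfold weilQuadratic weilFunctional weilArchTerm weilFirstPrimeQuadratic
  rw [weilPrimeTerm_of_tsupport_subset_log_three hk.1.continuous hks, hprime,
    weilPolarTerm_weilConv_weilReflect hg, weilArchIntegral_weilConv_weilReflect hg,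
    weilConv_weilReflect_apply_zero, hsplit]
  unfold weilNorm2Sq Literature.Analysis.SpecialFunctions.reDigammaQuarter
  have hsq : ((Real.sqrt 2 : ℝ) : ℂ) ≠ 0 := by
    have : (0 : ℝ) < Real.sqrt 2 := by positivity
    exact_mod_cast this.ne'
  rw [show ((Real.log 2 : ℝ) : ℂ) / (Real.sqrt 2 : ℂ) = ((Real.log 2 / Real.sqrt 2 : ℝ) : ℂ) by push_cast; ring,
    hsqrt]
  push_cast
  ring

/-- Real-part version: `Re Q(g) = E₂(g)` on `C((log 3)/2)`. [cite: Yoshida1992, §2 eq. (2.1) with the p = 2 term] -/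
theorem weilQuadratic_re_eq_weilFirstPrimeQuadratic (hg : IsWeilTest g)
    (hsupp : tsupport g ⊆ Icc (-(Real.log 3 / 2)) (Real.log 3 / 2)) :
    (weilQuadratic g).re = weilFirstPrimeQuadratic g := by
  rw [weilQuadratic_eq_weilFirstPrimeQuadratic hg hsupp, Complex.ofReal_re]

/-- On `C((log 3)/2)` the quadratic functional is real: `Im Q(g) = 0`. [folklore] -/
theorem weilQuadratic_im_eq_zero_of_tsupport_subset_log_three_half (hg : IsWeilTest g)
    (hsupp : tsupport g ⊆ Icc (-(Real.log 3 / 2)) (Real.log 3 / 2)) :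
    (weilQuadratic g).im = 0 := by
  rw [weilQuadratic_eq_weilFirstPrimeQuadratic hg hsupp, Complex.ofReal_im]

/-- **Reduction of first-prime Weil positivity to its analytic form**:
`WeilPositivityOn ((log 3)/2) ↔ ∀ g ∈ C((log 3)/2), 0 ≤ E₂(g)`. [cite: Yoshida1992, Thm 1 shape (§6) transported to a = (log 3)/2 with the p = 2 term] -/
theorem weilPositivityOn_log_three_half_iff :
    WeilPositivityOn (Real.log 3 / 2) ↔
      ∀ g : ℝ → ℂ, IsWeilTest g → tsupport g ⊆ Icc (-(Real.log 3 / 2)) (Real.log 3 / 2) →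
        0 ≤ weilFirstPrimeQuadratic g := by
  unfold WeilPositivityOn
  refine forall₃_congr fun g hg hsupp ↦ ?_
  rw [weilQuadratic_re_eq_weilFirstPrimeQuadratic hg hsupp]

/-- The direction a certificate uses: `E₂ ≥ 0` on `C((log 3)/2)` implies `WeilPositivityOn ((log 3)/2)`. [cite: Yoshida1992, Thm 1 shape (§6) transported to a = (log 3)/2 with the p = 2 term] -/
theorem weilPositivityOn_log_three_half_of_weilFirstPrimeQuadratic_nonneg
    (h : ∀ g : ℝ → ℂ, IsWeilTest g → tsupport g ⊆ Icc (-(Real.log 3 / 2)) (Real.log 3 / 2) →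
      0 ≤ weilFirstPrimeQuadratic g) :
    WeilPositivityOn (Real.log 3 / 2) :=
  weilPositivityOn_log_three_half_iff.2 h

end Literature.NumberTheory.LFunctions
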